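import Mathlib
import HarnessLib
import Literature.MathematicalPhysics.QuantumFieldTheory.Balaban1983to89.B13Contraction113
import Literature.MathematicalPhysics.QuantumFieldTheory.Balaban1983to89.B12Lineariz267
import Literature.MathematicalPhysics.QuantumFieldTheory.Balaban1983to89.B12LinearizAnalytic267
import Literature.MathematicalPhysics.QuantumFieldTheory.Balaban1983to89.B12JacobianTrLog268
import Literature.MathematicalPhysics.QuantumFieldTheory.Balaban1983to89.B12SecondOrder267

/-!
# B12 [Balaban1987RG1] p. 267 — «an analytic, 𝐠-valued function D̃(B′)»: the REAL STRUCTURE of the linearizing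
# change of variables `B′ = B − hD̃(B)` — `D̃` maps real fields to real fields, its derivative and the Jacobian
# operator `DΦ(B) = I − h∘DD̃(B)` commute with complex conjugation at real `B`, and (finite dimension) the Jacobian
# determinant `det DΦ(B)` is REAL and POSITIVE on the real ball, so that `log det DΦ(B)` is real there

CITATION. T. Bałaban, *Renormalization group approach to lattice gauge field theories. I. Generation of effective
actions in a small field approximation and a coupling constant renormalization in four dimensions*, Commun. Math.
Phys. 109 (1987) 249–301 [Balaban1987RG1] ("B12" of the cell), p. 267 (render `…1987-cmp109-rg-I-small-field-p019`;
PDF page = journal page − 248), with (2.12) p. 268 (`-p020`).  This file sits on top of the tree leaves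
`B12Lineariz267` (the substitution `B′ = B − hD̃(B)`; `D̃` BY NAME from the contraction module `B13Contraction113`;
uniqueness `eq_Dt_of_fixedPt`), `B12LinearizAnalytic267` (analyticity of `D̃`), `B12JacobianTrLog268` (`DΦ(B) =
1 − J(B)`, `J(B) = h∘DD̃(B)`; in finite dimension `det DΦ(B) ≠ 0`, `det DΦ(0) = 1`, analyticity of `B ↦ det DΦ(B)`)
and `B12SecondOrder267` (`‖Φ(B)‖ < R` on the ball); all are imported and used BY NAME, nothing of them is re-derived.

THE PRINT (verbatim).  B12 p. 267 [PDF 19]: *«At first we introduce an operator h. It transforms 𝐠-valued functions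
B defined at bonds of the lattice T⁽ᵏ⁺¹⁾ into such functions defined at bonds of T⁽ᵏ⁾.»* … *«We are looking for an
analytic, 𝐠-valued function D̃(B′), defined at bonds of T⁽ᵏ⁺¹⁾, and such that the transformation B′ = B − hD̃(B)
linearizes the function Q̃(B′). The function D̃(B) is determined by the equation LQ̃B′ + C̃(B′) = LQ̃B − D̃(B) +
C̃(B − hD̃(B)) = LQ̃B. It is easy to prove, following the proofs in the above mentioned papers, that there exists
exactly one solution of this equation, and that it is an analytic function of B.»* … *«The above change of variables
yields the integral with the δ-function δ(Q̃B).»*; the change of variables is made in the integral (2.10)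
*«(2.1) = logN_k′⁻¹ ∫ dB′σ(B′)δ(Q̃(B′)) × χ_k exp[…]»* over the (real, `𝐠`-valued) field `B′`, and its Jacobian
enters the new action (2.12) p. 268 as the term *«Tr log(I − h((δ/δB)D̃)(g_kCB))»*.  READING: `𝐠` is the (real)
Lie algebra of the gauge group, so «𝐠-valued» says the fields `B`, `B′` and the functions `hB`, `D̃(B)` are REAL
objects, while «analytic» (used throughout [B12] for the complexified small-field variables) says `D̃` extends
analytically to complex `B`; the substitution `B′ = B − hD̃(B)` in the real integral `∫dB′ …` therefore requires that
`D̃` map real fields to real fields and produces the Jacobian `|det DΦ(B)|`, which is `det DΦ(B) = exp Tr log DΦ(B)`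
exactly when `det DΦ(B) > 0` on the real fields — the reality ∕ positivity point recorded as NOT TYPED in
`B12JacobianTrLog268` (its header's NOT TYPED list: "needs the real structure" — our words, not the print's).

THE TYPING (schematic, exactly as in the four leaves below this one — cell DIVERGENCE row for this file).  `𝒴`, `𝒳`
complex Banach spaces; `hop : 𝒳 →ₗ[ℂ] 𝒴` (print's `h`) with `‖hop X‖ ≤ b‖X‖`; `Ct : 𝒴 → 𝒳` (print's `C̃`) with
`B13Contraction113.QuadAnalytic Ct C₂ R` and `AnalyticOnNhd ℂ Ct {‖Y‖ < R}`; `9C₂bε < 1` (resp. `≤ 1/2` where the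
finite-dimensional results of `B12JacobianTrLog268` are invoked), `3ε ≤ R`; `D̃` HYPOTHESIS-STYLE: any `Dt : 𝒴 → 𝒳`
with `Dt B ∈ closedBall 0 (4C₂ε²)` and `Ct (B − hop (Dt B)) = Dt B` on `‖B‖ < ε`.  The REAL STRUCTURE («𝐠-valued»)
is TYPED as a pair of CONJUGATIONS: antilinear isometric involutions `κX : 𝒳 ≃ₗᵢ⋆[ℂ] 𝒳`, `κY : 𝒴 ≃ₗᵢ⋆[ℂ] 𝒴`
(Mathlib's conjugate-linear isometric equivalences, with the hypotheses `κX (κX X) = X`, `κY (κY B) = B`), the real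
(`𝐠`-valued) fields being the fixed vectors `κY B = B`; the print's `h` and `C̃` are real («transforms 𝐠-valued
functions … into such functions»), TYPED as the equivariance hypotheses `hop (κX X) = κY (hop X)` and
`Ct (κY Y) = κX (Ct Y)` on `‖Y‖ < R`.  No definitions are introduced: all objects are written out.

CONTENTS.  §1 [folklore] LINEAR ALGEBRA OF AN ANTILINEAR INVOLUTION (any complex vector space, then finite
dimension): an additive antilinear involution `κ` has a CONJUGATE BASIS `f = κ ∘ e` whose coordinates are the complex
conjugates of the `e`-coordinates of `κ v`; the matrix of a `κ`-commuting operator `T` (`T (κ v) = κ (T v)`) in `f`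
is the entrywise conjugate of its matrix in `e`; hence `det T` and `Tr T` are REAL (`conj (det T) = det T`,
`conj (Tr T) = Tr T`; Mathlib `Module.Basis.mk`, `LinearMap.toMatrix`, `RingHom.map_det`, `AddMonoidHom.map_trace`);
and, in a normed space, the fixed set `{κ B = B}` of a conjugation is closed and (real-)convex.  §2 [folklore]
EQUIVARIANCE (any complex Banach spaces): by UNIQUENESS of the solution in the ball (`B12Lineariz267.eq_Dt_of_fixedPt`)
`D̃(κB) = κD̃(B)` on `‖B‖ < ε`, so `D̃` MAPS REAL FIELDS TO REAL FIELDS («𝐠-valued function D̃») and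
`Φ(κB) = κΦ(B)`; the Fréchet derivative satisfies `DD̃(κB₀)(κv) = κ(DD̃(B₀)v)` (proved from the DEFINITION of the
derivative, `κ` being an isometry — there is no complex chain rule through antilinear maps), hence at a real point
`B₀` the operators `DD̃(B₀)`, `J(B₀) = h∘DD̃(B₀)` and `DΦ(B₀) = 1 − J(B₀)` COMMUTE WITH THE CONJUGATION.
§3 [folklore] FINITE DIMENSION (`𝒴` finite-dimensional, `9C₂bε ≤ 1/2`): at a real point `B₀` of the ball,
`det DΦ(B₀)` and `Tr J(B₀)` are REAL (§1), and `det DΦ(B₀) > 0` — the argument: `B ↦ det DΦ(B)` is real-valued and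
continuous (`B12JacobianTrLog268.analyticOnNhd_det_jacobian`) on the CONVEX, hence connected, real ball
`{κB = B} ∩ {‖B‖ < ε}`, never zero there (`det_jacobian_ne_zero`) and `= 1` at `B = 0` (`det_jacobian_zero`), so it
is positive by the intermediate value theorem; consequently the principal-branch `log det DΦ(B₀)` is the REAL number
`Real.log (det DΦ(B₀))`.  §4 a transcription theorem [cite] assembling §2–§3 for the `D̃` of
`B12Lineariz267.p267_linearizing_change_of_variables`, and a degenerate model (`𝒳 = 𝒴 = ℂ`, `κ` = complex
conjugation `starₗᵢ ℂ`) showing the hypotheses are jointly satisfiable.  NOT TYPED: the reality of the OPERATOR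
`Tr log DΦ(B₀) = Tr mlog(1 − J(B₀))` itself (only `exp` of it, `= det DΦ(B₀)` by `B12JacobianTrLog268`, is shown real
and positive, whence its principal logarithm is real; the identification of `Tr mlog(1 − J)` with that real logarithm
modulo `2πiℤ` is not pursued), the concrete real structure of [B12] (`𝐠 = 𝔰𝔲(n)`-valued lattice functions, `κ` =
the Cartan conjugation), the lattice formula of `h`, the measure-theoretic change of variables in (2.10) itself.
Everything is [folklore] except §4; nothing of [B12] is asserted; NOT summit progress.
v1.1 (docstring-only, same 33 theorems + 1 example, proofs byte-identical to v1 p189060): two internal phrases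
taken out of guillemets (guillemets are reserved for the verbatim print: "needs the real structure" is leaf
`B12JacobianTrLog268`'s header wording, "connected ball" is the cell's GAPS C-adv9-23 (e) wording) and the (2.12)
term quoted in full in `p267_real_jacobian_findim`'s docstring.
v1.2 (docstring-only, same 33 theorems + 1 example, proofs byte-identical to v1.1 p189142): PRIOR ART in the tree
recorded (cross-read finding, reader outside the lineage): §1's `conj_det_eq` is the DIAGONAL CASE of
`Literature.AlgebraicGeometry.HodgeTheory.det_eq_conj_det_of_semilinearEquiv`
(`Literature/AlgebraicGeometry/HodgeTheory/DetRestrictConjugateEigenspace.lean`: for a conjugate-linear equivalence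
`φ : E₁ ≃ₛₗ[starRingEnd ℂ] E₂` and `g ∘ φ = φ ∘ f`, `det g = conj (det f)`) with `E₁ = E₂ = 𝒴`, `φ := κ`, `f = g = T`;
it is kept here with its own conjugate-basis proof because `conj_trace_eq` needs the same basis
(`exists_conj_basis`, `toMatrix_conj_basis`), for which no tree or Mathlib analogue was found; that module is not
imported (different layer), so nothing is re-derived from an import.
-/

open Metric Set Filter Topology Asymptotics

namespace Literature.MathematicalPhysics.QuantumFieldTheory.Balaban1983to89.B12JacobianReal267

open Literature.MathematicalPhysics.QuantumFieldTheory.Balaban1983to89.B13Contraction113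
open Literature.MathematicalPhysics.QuantumFieldTheory.Balaban1983to89.B12Lineariz267
open Literature.MathematicalPhysics.QuantumFieldTheory.Balaban1983to89.B12LinearizAnalytic267
open Literature.MathematicalPhysics.QuantumFieldTheory.Balaban1983to89.B12JacobianTrLog268
open Literature.MathematicalPhysics.QuantumFieldTheory.Balaban1983to89.B12SecondOrder267

/-! ## §1  Linear algebra of an additive antilinear involution: conjugate basis, real determinant and trace of a
commuting operator; the real subspace of a conjugation is closed and convex -/
section conjalg

variable {𝒴 : Type*} [AddCommGroup 𝒴] [Module ℂ 𝒴]

omit [Module ℂ 𝒴] in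
/-- An additive map sends `0` to `0`. [folklore] -/
theorem conj_zero (κ : 𝒴 → 𝒴) (hadd : ∀ v w, κ (v + w) = κ v + κ w) : κ 0 = 0 := by
  have h := hadd 0 0
  rw [add_zero] at h
  simpa using h

/-- An additive antilinear map applied to a finite linear combination conjugates the coefficients. [folklore] -/
theorem conj_sum_smul {ι : Type*} (s : Finset ι) (κ : 𝒴 → 𝒴) (hadd : ∀ v w, κ (v + w) = κ v + κ w)
    (hsmul : ∀ (c : ℂ) (v : 𝒴), κ (c • v) = starRingEnd ℂ c • κ v) (c : ι → ℂ) (v : ι → 𝒴) :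
    κ (∑ i ∈ s, c i • v i) = ∑ i ∈ s, starRingEnd ℂ (c i) • κ (v i) := by
  have h := map_sum (AddMonoidHom.mk' κ hadd) (fun i => c i • v i) s
  simp only [AddMonoidHom.mk'_apply] at h
  rw [h]
  exact Finset.sum_congr rfl fun i _ => hsmul _ _

variable [FiniteDimensional ℂ 𝒴]

/-- **Conjugate basis.** For an additive antilinear involution `κ` of a finite-dimensional complex space there are
bases `e`, `f` with `f = κ ∘ e`, and the `f`-coordinates of any `v` are the complex conjugates of the
`e`-coordinates of `κ v`. [folklore] -/
theorem exists_conj_basis (κ : 𝒴 → 𝒴) (hadd : ∀ v w, κ (v + w) = κ v + κ w)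
    (hsmul : ∀ (c : ℂ) (v : 𝒴), κ (c • v) = starRingEnd ℂ c • κ v) (hκ : ∀ v, κ (κ v) = v) :
    ∃ e f : Module.Basis (Fin (Module.finrank ℂ 𝒴)) ℂ 𝒴,
      (∀ i, f i = κ (e i)) ∧ ∀ v i, f.repr v i = starRingEnd ℂ (e.repr (κ v) i) := by
  set e := Module.finBasis ℂ 𝒴
  have h0 : κ 0 = 0 := conj_zero κ hadd
  have hli : LinearIndependent ℂ (fun i => κ (e i)) := by
    rw [Fintype.linearIndependent_iff]
    intro g hg i
    have h1 : κ (∑ j, g j • κ (e j)) = ∑ j, starRingEnd ℂ (g j) • e j := by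
      rw [conj_sum_smul _ κ hadd hsmul]
      simp only [hκ]
    rw [hg, h0] at h1
    have h2 := (Fintype.linearIndependent_iff.mp e.linearIndependent) (fun j => starRingEnd ℂ (g j)) h1.symm i
    simpa using h2
  have hexp : ∀ v : 𝒴, v = ∑ i, starRingEnd ℂ (e.repr (κ v) i) • κ (e i) := by
    intro v
    have h1 : κ v = ∑ i, e.repr (κ v) i • e i := (e.sum_repr (κ v)).symm
    have h2 : κ (κ v) = κ (∑ i, e.repr (κ v) i • e i) := by rw [← h1]
    rw [hκ] at h2
    exact h2.trans (by rw [conj_sum_smul _ κ hadd hsmul])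
  have hsp : ⊤ ≤ Submodule.span ℂ (Set.range fun i => κ (e i)) := by
    intro v _
    rw [hexp v]
    exact Submodule.sum_mem _ fun i _ => Submodule.smul_mem _ _ (Submodule.subset_span ⟨i, rfl⟩)
  set f := Module.Basis.mk hli hsp with hf_def
  have hf : ∀ i, f i = κ (e i) := fun i => by simp [f]
  refine ⟨e, f, hf, fun v i => ?_⟩
  have hv : f.equivFun.symm (fun i => starRingEnd ℂ (e.repr (κ v) i)) = v := by
    rw [Module.Basis.equivFun_symm_apply]
    simp only [hf]
    exact (hexp v).symm
  have hv' := congrArg f.equivFun hv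
  rw [LinearEquiv.apply_symm_apply] at hv'
  have h := congrFun hv' i
  rw [Module.Basis.equivFun_apply] at h
  exact h.symm

omit [FiniteDimensional ℂ 𝒴] in
/-- **The matrix of a `κ`-commuting operator in the conjugate basis is the entrywise conjugate of its matrix in
`e`.** [folklore] -/
theorem toMatrix_conj_basis (κ : 𝒴 → 𝒴) (hκ : ∀ v, κ (κ v) = v) {n : ℕ} (e f : Module.Basis (Fin n) ℂ 𝒴)
    (hfe : ∀ i, f i = κ (e i)) (hrepr : ∀ v i, f.repr v i = starRingEnd ℂ (e.repr (κ v) i))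
    (T : 𝒴 →ₗ[ℂ] 𝒴) (hT : ∀ v, T (κ v) = κ (T v)) :
    LinearMap.toMatrix f f T = (starRingEnd ℂ).mapMatrix (LinearMap.toMatrix e e T) := by
  ext i j
  rw [RingHom.mapMatrix_apply, Matrix.map_apply, LinearMap.toMatrix_apply, LinearMap.toMatrix_apply, hrepr,
    hfe, hT, hκ]

/-- **An operator commuting with an additive antilinear involution has REAL DETERMINANT**:
`conj (det T) = det T`.  PRIOR ART (tree): the diagonal case `E₁ = E₂`, `φ := κ`, `f = g = T` of
`Literature.AlgebraicGeometry.HodgeTheory.det_eq_conj_det_of_semilinearEquiv` (`det g = conj (det f)` whenever a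
conjugate-linear equivalence `φ` intertwines `f` and `g`); proved here independently in the conjugate basis of
`exists_conj_basis`, which `conj_trace_eq` below reuses. [folklore] -/
theorem conj_det_eq (κ : 𝒴 → 𝒴) (hadd : ∀ v w, κ (v + w) = κ v + κ w)
    (hsmul : ∀ (c : ℂ) (v : 𝒴), κ (c • v) = starRingEnd ℂ c • κ v) (hκ : ∀ v, κ (κ v) = v)
    (T : 𝒴 →ₗ[ℂ] 𝒴) (hT : ∀ v, T (κ v) = κ (T v)) :
    starRingEnd ℂ (LinearMap.det T) = LinearMap.det T := by
  obtain ⟨e, f, hfe, hrepr⟩ := exists_conj_basis κ hadd hsmul hκ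
  rw [← LinearMap.det_toMatrix e, RingHom.map_det, ← toMatrix_conj_basis κ hκ e f hfe hrepr T hT,
    LinearMap.det_toMatrix, LinearMap.det_toMatrix]

/-- **An operator commuting with an additive antilinear involution has REAL TRACE**: `conj (Tr T) = Tr T`.
[folklore] -/
theorem conj_trace_eq (κ : 𝒴 → 𝒴) (hadd : ∀ v w, κ (v + w) = κ v + κ w)
    (hsmul : ∀ (c : ℂ) (v : 𝒴), κ (c • v) = starRingEnd ℂ c • κ v) (hκ : ∀ v, κ (κ v) = v)
    (T : 𝒴 →ₗ[ℂ] 𝒴) (hT : ∀ v, T (κ v) = κ (T v)) :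
    starRingEnd ℂ (LinearMap.trace ℂ 𝒴 T) = LinearMap.trace ℂ 𝒴 T := by
  obtain ⟨e, f, hfe, hrepr⟩ := exists_conj_basis κ hadd hsmul hκ
  rw [LinearMap.trace_eq_matrix_trace ℂ e, AddMonoidHom.map_trace, ← RingHom.mapMatrix_apply,
    ← toMatrix_conj_basis κ hκ e f hfe hrepr T hT, ← LinearMap.trace_eq_matrix_trace ℂ f,
    ← LinearMap.trace_eq_matrix_trace ℂ e]

/-- Real determinant, imaginary-part form: `Im (det T) = 0`. [folklore] -/
theorem det_im_eq_zero (κ : 𝒴 → 𝒴) (hadd : ∀ v w, κ (v + w) = κ v + κ w)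
    (hsmul : ∀ (c : ℂ) (v : 𝒴), κ (c • v) = starRingEnd ℂ c • κ v) (hκ : ∀ v, κ (κ v) = v)
    (T : 𝒴 →ₗ[ℂ] 𝒴) (hT : ∀ v, T (κ v) = κ (T v)) : (LinearMap.det T).im = 0 :=
  Complex.conj_eq_iff_im.mp (conj_det_eq κ hadd hsmul hκ T hT)

/-- Real determinant, real-part form: `det T = Re (det T)` (as a complex number). [folklore] -/
theorem det_eq_ofReal_re (κ : 𝒴 → 𝒴) (hadd : ∀ v w, κ (v + w) = κ v + κ w)
    (hsmul : ∀ (c : ℂ) (v : 𝒴), κ (c • v) = starRingEnd ℂ c • κ v) (hκ : ∀ v, κ (κ v) = v)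
    (T : 𝒴 →ₗ[ℂ] 𝒴) (hT : ∀ v, T (κ v) = κ (T v)) :
    LinearMap.det T = ((LinearMap.det T).re : ℂ) :=
  (Complex.conj_eq_iff_re.mp (conj_det_eq κ hadd hsmul hκ T hT)).symm

/-- Real trace, imaginary-part form: `Im (Tr T) = 0`. [folklore] -/
theorem trace_im_eq_zero (κ : 𝒴 → 𝒴) (hadd : ∀ v w, κ (v + w) = κ v + κ w)
    (hsmul : ∀ (c : ℂ) (v : 𝒴), κ (c • v) = starRingEnd ℂ c • κ v) (hκ : ∀ v, κ (κ v) = v)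
    (T : 𝒴 →ₗ[ℂ] 𝒴) (hT : ∀ v, T (κ v) = κ (T v)) : (LinearMap.trace ℂ 𝒴 T).im = 0 :=
  Complex.conj_eq_iff_im.mp (conj_trace_eq κ hadd hsmul hκ T hT)

end conjalg

section conjnormed

variable {𝒴 : Type*} [NormedAddCommGroup 𝒴] [NormedSpace ℂ 𝒴]

/-- A conjugation (antilinear isometric equivalence) is REAL-linear: `κ (t • v) = t • κ v` for `t : ℝ`. [folklore] -/
theorem conj_real_smul (κ : 𝒴 ≃ₗᵢ⋆[ℂ] 𝒴) (t : ℝ) (v : 𝒴) : κ (t • v) = t • κ v := by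
  rw [RCLike.real_smul_eq_coe_smul (K := ℂ) t v, κ.map_smulₛₗ, RCLike.conj_ofReal,
    ← RCLike.real_smul_eq_coe_smul (K := ℂ)]

/-- **The real subspace `{κ B = B}` of a conjugation is (real-)CONVEX.** [folklore] -/
theorem convex_fixed (κ : 𝒴 ≃ₗᵢ⋆[ℂ] 𝒴) : Convex ℝ {B : 𝒴 | κ B = B} := by
  intro x hx y hy a c _ _ _
  simp only [Set.mem_setOf_eq] at hx hy ⊢
  rw [map_add, conj_real_smul, conj_real_smul, hx, hy]

/-- The real subspace `{κ B = B}` of a conjugation is CLOSED. [folklore] -/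
theorem isClosed_fixed (κ : 𝒴 ≃ₗᵢ⋆[ℂ] 𝒴) : IsClosed {B : 𝒴 | κ B = B} :=
  isClosed_eq κ.continuous continuous_id

/-- **The real ball `{κ B = B} ∩ {‖B‖ < ε}` is convex, hence (pre)connected** — the "connected ball" (wording of the
cell's hand certificate GAPS C-adv9-23 (e), not of the print) of the positivity argument of §3. [folklore] -/
theorem isPreconnected_fixed_inter_ball (κ : 𝒴 ≃ₗᵢ⋆[ℂ] 𝒴) (ε : ℝ) :
    IsPreconnected ({B : 𝒴 | κ B = B} ∩ ball (0:𝒴) ε) :=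
  ((convex_fixed κ).inter (convex_ball (0:𝒴) ε)).isPreconnected

end conjnormed

/-! ## §2  Equivariance under the conjugations: `D̃(κB) = κD̃(B)` (so `D̃` is real on real fields), `Φ(κB) = κΦ(B)`,
`DD̃(κB₀)∘κ = κ∘DD̃(B₀)`; at a real point `DD̃`, `J` and `DΦ` commute with `κ` -/
section equivariance

variable {𝒳 𝒴 : Type*} [NormedAddCommGroup 𝒳] [NormedSpace ℂ 𝒳] [CompleteSpace 𝒳]
  [NormedAddCommGroup 𝒴] [NormedSpace ℂ 𝒴] [CompleteSpace 𝒴]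
  {hop : 𝒳 →ₗ[ℂ] 𝒴} {Ct : 𝒴 → 𝒳} {C₂ R b ε : ℝ} {Dt : 𝒴 → 𝒳}
  {κX : 𝒳 ≃ₗᵢ⋆[ℂ] 𝒳} {κY : 𝒴 ≃ₗᵢ⋆[ℂ] 𝒴}

omit [CompleteSpace 𝒴] in
/-- **`D̃(κB) = κD̃(B)` on `‖B‖ < ε`** — the solution of `C̃(B − hX) = X` in the ball is conjugation-equivariant when
`h` and `C̃` are: `κ_𝒳 D̃(κ_𝒴 B)` solves the equation for the parameter `B` in the same ball, so equals `D̃(B)` by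
UNIQUENESS (`B12Lineariz267.eq_Dt_of_fixedPt`, «exactly one solution»). [folklore] -/
theorem Dt_conj (hC : QuadAnalytic Ct C₂ R) (hC₂ : 0 ≤ C₂) (hb : 0 ≤ b) (hHop : ∀ X, ‖hop X‖ ≤ b * ‖X‖)
    (hq : 9 * C₂ * b * ε < 1) (hRC : 3 * ε ≤ R)
    (hDball : ∀ B : 𝒴, ‖B‖ < ε → Dt B ∈ closedBall (0:𝒳) (4 * C₂ * ε ^ 2))
    (hDfix : ∀ B : 𝒴, ‖B‖ < ε → Ct (B - hop (Dt B)) = Dt B)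
    (hκX : ∀ X, κX (κX X) = X) (hκY : ∀ B, κY (κY B) = B)
    (hhop : ∀ X, hop (κX X) = κY (hop X)) (hCt : ∀ Y : 𝒴, ‖Y‖ < R → Ct (κY Y) = κX (Ct Y))
    {B : 𝒴} (hB : ‖B‖ < ε) : Dt (κY B) = κX (Dt B) := by
  have hκB : ‖κY B‖ < ε := by rwa [κY.norm_map]
  have hX'ball : κX (Dt (κY B)) ∈ closedBall (0:𝒳) (4 * C₂ * ε ^ 2) := by
    have h := hDball _ hκB
    rw [mem_closedBall_zero_iff] at h ⊢
    rwa [κX.norm_map]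
  have hX'fix : Ct (B - hop (κX (Dt (κY B)))) = κX (Dt (κY B)) := by
    have h1 : B - hop (κX (Dt (κY B))) = κY (κY B - hop (Dt (κY B))) := by
      rw [map_sub, hκY, hhop]
    rw [h1, hCt _ (norm_phi_lt hC hC₂ hb hHop hq hRC hDball hDfix hκB), hDfix _ hκB]
  have h := eq_Dt_of_fixedPt hC hC₂ hb hHop hq hRC hDball hDfix hB hX'ball hX'fix
  have h2 := congrArg κX h
  rwa [hκX] at h2

omit [CompleteSpace 𝒴] in
/-- **«𝐠-valued function D̃»: `D̃` MAPS REAL FIELDS TO REAL FIELDS** — `κ_𝒴 B = B ⇒ κ_𝒳 D̃(B) = D̃(B)` on the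
ball. [folklore] -/
theorem Dt_real (hC : QuadAnalytic Ct C₂ R) (hC₂ : 0 ≤ C₂) (hb : 0 ≤ b) (hHop : ∀ X, ‖hop X‖ ≤ b * ‖X‖)
    (hq : 9 * C₂ * b * ε < 1) (hRC : 3 * ε ≤ R)
    (hDball : ∀ B : 𝒴, ‖B‖ < ε → Dt B ∈ closedBall (0:𝒳) (4 * C₂ * ε ^ 2))
    (hDfix : ∀ B : 𝒴, ‖B‖ < ε → Ct (B - hop (Dt B)) = Dt B)
    (hκX : ∀ X, κX (κX X) = X) (hκY : ∀ B, κY (κY B) = B)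
    (hhop : ∀ X, hop (κX X) = κY (hop X)) (hCt : ∀ Y : 𝒴, ‖Y‖ < R → Ct (κY Y) = κX (Ct Y))
    {B : 𝒴} (hB : ‖B‖ < ε) (hreal : κY B = B) : κX (Dt B) = Dt B := by
  rw [← Dt_conj hC hC₂ hb hHop hq hRC hDball hDfix hκX hκY hhop hCt hB, hreal]

omit [CompleteSpace 𝒴] in
/-- **`Φ(κB) = κΦ(B)`** for `Φ(B) = B − hD̃(B)` on the ball; in particular `Φ` maps real fields to real fields.
[folklore] -/
theorem phi_conj (hC : QuadAnalytic Ct C₂ R) (hC₂ : 0 ≤ C₂) (hb : 0 ≤ b) (hHop : ∀ X, ‖hop X‖ ≤ b * ‖X‖)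
    (hq : 9 * C₂ * b * ε < 1) (hRC : 3 * ε ≤ R)
    (hDball : ∀ B : 𝒴, ‖B‖ < ε → Dt B ∈ closedBall (0:𝒳) (4 * C₂ * ε ^ 2))
    (hDfix : ∀ B : 𝒴, ‖B‖ < ε → Ct (B - hop (Dt B)) = Dt B)
    (hκX : ∀ X, κX (κX X) = X) (hκY : ∀ B, κY (κY B) = B)
    (hhop : ∀ X, hop (κX X) = κY (hop X)) (hCt : ∀ Y : 𝒴, ‖Y‖ < R → Ct (κY Y) = κX (Ct Y))
    {B : 𝒴} (hB : ‖B‖ < ε) : κY B - hop (Dt (κY B)) = κY (B - hop (Dt B)) := by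
  rw [map_sub, ← hhop, Dt_conj hC hC₂ hb hHop hq hRC hDball hDfix hκX hκY hhop hCt hB]

omit [CompleteSpace 𝒴] in
/-- `Φ` maps real fields to real fields: `κB = B ⇒ κΦ(B) = Φ(B)`. [folklore] -/
theorem phi_real (hC : QuadAnalytic Ct C₂ R) (hC₂ : 0 ≤ C₂) (hb : 0 ≤ b) (hHop : ∀ X, ‖hop X‖ ≤ b * ‖X‖)
    (hq : 9 * C₂ * b * ε < 1) (hRC : 3 * ε ≤ R)
    (hDball : ∀ B : 𝒴, ‖B‖ < ε → Dt B ∈ closedBall (0:𝒳) (4 * C₂ * ε ^ 2))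
    (hDfix : ∀ B : 𝒴, ‖B‖ < ε → Ct (B - hop (Dt B)) = Dt B)
    (hκX : ∀ X, κX (κX X) = X) (hκY : ∀ B, κY (κY B) = B)
    (hhop : ∀ X, hop (κX X) = κY (hop X)) (hCt : ∀ Y : 𝒴, ‖Y‖ < R → Ct (κY Y) = κX (Ct Y))
    {B : 𝒴} (hB : ‖B‖ < ε) (hreal : κY B = B) : κY (B - hop (Dt B)) = B - hop (Dt B) := by
  rw [← phi_conj hC hC₂ hb hHop hq hRC hDball hDfix hκX hκY hhop hCt hB, hreal]

/-- **`DD̃(κB₀)(κv) = κ(DD̃(B₀)v)`** on the ball — the Fréchet derivative of the equivariant analytic map `D̃` is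
equivariant.  Proved from the definition of the derivative: `D̃ = κ_𝒳 ∘ D̃ ∘ κ_𝒴` near `κB₀`, and for the complex-linear
operator `v ↦ κ_𝒳(DD̃(B₀)(κ_𝒴 v))` the remainder is the isometric image of the remainder of `D̃` at `B₀`. [folklore] -/
theorem fderiv_Dt_conj (hC : QuadAnalytic Ct C₂ R) (hCa : AnalyticOnNhd ℂ Ct {Y : 𝒴 | ‖Y‖ < R})
    (hC₂ : 0 ≤ C₂) (hb : 0 ≤ b) (hHop : ∀ X, ‖hop X‖ ≤ b * ‖X‖) (hq : 9 * C₂ * b * ε < 1)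
    (hRC : 3 * ε ≤ R) (hDball : ∀ B : 𝒴, ‖B‖ < ε → Dt B ∈ closedBall (0:𝒳) (4 * C₂ * ε ^ 2))
    (hDfix : ∀ B : 𝒴, ‖B‖ < ε → Ct (B - hop (Dt B)) = Dt B)
    (hκX : ∀ X, κX (κX X) = X) (hκY : ∀ B, κY (κY B) = B)
    (hhop : ∀ X, hop (κX X) = κY (hop X)) (hCt : ∀ Y : 𝒴, ‖Y‖ < R → Ct (κY Y) = κX (Ct Y))
    {B₀ : 𝒴} (hB₀ : ‖B₀‖ < ε) (v : 𝒴) :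
    fderiv ℂ Dt (κY B₀) (κY v) = κX (fderiv ℂ Dt B₀ v) := by
  set L : 𝒴 →L[ℂ] 𝒳 := fderiv ℂ Dt B₀ with hL_def
  have hL : HasFDerivAt Dt L B₀ :=
    (analyticAt_Dt hC hCa hC₂ hb hHop hq hRC hDball hDfix hB₀).differentiableAt.hasFDerivAt
  let L'ₗ : 𝒴 →ₗ[ℂ] 𝒳 :=
    { toFun := fun w => κX (L (κY w))
      map_add' := fun w₁ w₂ => by simp only [map_add]
      map_smul' := fun c w => by
        simp only [RingHom.id_apply]
        rw [κY.map_smulₛₗ, map_smul, κX.map_smulₛₗ, starRingEnd_self_apply] }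
  have hcont : Continuous L'ₗ := κX.continuous.comp (L.continuous.comp κY.continuous)
  let L' : 𝒴 →L[ℂ] 𝒳 := ⟨L'ₗ, hcont⟩
  have hL'apply : ∀ w, L' w = κX (L (κY w)) := fun w => rfl
  have hderiv : HasFDerivAt Dt L' (κY B₀) := by
    rw [hasFDerivAt_iff_isLittleO_nhds_zero] at hL ⊢
    have hκ0 : Tendsto (fun w : 𝒴 => κY w) (𝓝 0) (𝓝 0) := by
      have h := κY.continuous.tendsto (0:𝒴)
      rwa [map_zero] at h
    have h1 := hL.comp_tendsto hκ0
    have h2 : (fun w : 𝒴 => ‖Dt (B₀ + κY w) - Dt B₀ - L (κY w)‖) =o[𝓝 (0:𝒴)] fun w => w := by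
      refine h1.norm_left.trans_isBigO (IsBigO.of_bound 1 (Eventually.of_forall fun w => ?_))
      simp [κY.norm_map]
    refine IsLittleO.of_norm_left (h2.congr' ?_ EventuallyEq.rfl)
    have hsmall : ∀ᶠ w : 𝒴 in 𝓝 0, ‖B₀ + κY w‖ < ε := by
      have hc : Continuous fun w : 𝒴 => ‖B₀ + κY w‖ := continuous_norm.comp (continuous_const.add κY.continuous)
      exact (isOpen_lt hc continuous_const).mem_nhds (by simpa using hB₀)
    filter_upwards [hsmall] with w hw
    have e1 : κY B₀ + w = κY (B₀ + κY w) := by rw [map_add, hκY]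
    rw [e1, Dt_conj hC hC₂ hb hHop hq hRC hDball hDfix hκX hκY hhop hCt hw,
      Dt_conj hC hC₂ hb hHop hq hRC hDball hDfix hκX hκY hhop hCt hB₀, hL'apply, ← map_sub κX, ← map_sub κX,
      κX.norm_map]
  rw [hderiv.fderiv, hL'apply, hκY]

/-- **At a REAL point `B₀` the derivative `DD̃(B₀)` COMMUTES WITH THE CONJUGATIONS**: `DD̃(B₀)(κv) = κ(DD̃(B₀)v)`;
in particular it maps real directions to real vectors. [folklore] -/
theorem fderiv_Dt_real (hC : QuadAnalytic Ct C₂ R) (hCa : AnalyticOnNhd ℂ Ct {Y : 𝒴 | ‖Y‖ < R})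
    (hC₂ : 0 ≤ C₂) (hb : 0 ≤ b) (hHop : ∀ X, ‖hop X‖ ≤ b * ‖X‖) (hq : 9 * C₂ * b * ε < 1)
    (hRC : 3 * ε ≤ R) (hDball : ∀ B : 𝒴, ‖B‖ < ε → Dt B ∈ closedBall (0:𝒳) (4 * C₂ * ε ^ 2))
    (hDfix : ∀ B : 𝒴, ‖B‖ < ε → Ct (B - hop (Dt B)) = Dt B)
    (hκX : ∀ X, κX (κX X) = X) (hκY : ∀ B, κY (κY B) = B)
    (hhop : ∀ X, hop (κX X) = κY (hop X)) (hCt : ∀ Y : 𝒴, ‖Y‖ < R → Ct (κY Y) = κX (Ct Y))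
    {B₀ : 𝒴} (hB₀ : ‖B₀‖ < ε) (hreal : κY B₀ = B₀) (v : 𝒴) :
    fderiv ℂ Dt B₀ (κY v) = κX (fderiv ℂ Dt B₀ v) := by
  have h := fderiv_Dt_conj hC hCa hC₂ hb hHop hq hRC hDball hDfix hκX hκY hhop hCt hB₀ v
  rwa [hreal] at h

/-- **`J(κB₀)(κv) = κ(J(B₀)v)`** for the operator `J(B) = h∘DD̃(B)` of (2.12). [folklore] -/
theorem jacobianOp_conj (hC : QuadAnalytic Ct C₂ R) (hCa : AnalyticOnNhd ℂ Ct {Y : 𝒴 | ‖Y‖ < R})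
    (hC₂ : 0 ≤ C₂) (hb : 0 ≤ b) (hHop : ∀ X, ‖hop X‖ ≤ b * ‖X‖) (hq : 9 * C₂ * b * ε < 1)
    (hRC : 3 * ε ≤ R) (hDball : ∀ B : 𝒴, ‖B‖ < ε → Dt B ∈ closedBall (0:𝒳) (4 * C₂ * ε ^ 2))
    (hDfix : ∀ B : 𝒴, ‖B‖ < ε → Ct (B - hop (Dt B)) = Dt B)
    (hκX : ∀ X, κX (κX X) = X) (hκY : ∀ B, κY (κY B) = B)
    (hhop : ∀ X, hop (κX X) = κY (hop X)) (hCt : ∀ Y : 𝒴, ‖Y‖ < R → Ct (κY Y) = κX (Ct Y))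
    {B₀ : 𝒴} (hB₀ : ‖B₀‖ < ε) (v : 𝒴) :
    (hop.mkContinuous b hHop ∘L fderiv ℂ Dt (κY B₀)) (κY v) =
      κY ((hop.mkContinuous b hHop ∘L fderiv ℂ Dt B₀) v) := by
  simp only [ContinuousLinearMap.comp_apply, LinearMap.mkContinuous_apply]
  rw [fderiv_Dt_conj hC hCa hC₂ hb hHop hq hRC hDball hDfix hκX hκY hhop hCt hB₀, hhop]

/-- **At a real point `J(B₀) = h∘DD̃(B₀)` COMMUTES WITH THE CONJUGATION.** [folklore] -/
theorem jacobianOp_real (hC : QuadAnalytic Ct C₂ R) (hCa : AnalyticOnNhd ℂ Ct {Y : 𝒴 | ‖Y‖ < R})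
    (hC₂ : 0 ≤ C₂) (hb : 0 ≤ b) (hHop : ∀ X, ‖hop X‖ ≤ b * ‖X‖) (hq : 9 * C₂ * b * ε < 1)
    (hRC : 3 * ε ≤ R) (hDball : ∀ B : 𝒴, ‖B‖ < ε → Dt B ∈ closedBall (0:𝒳) (4 * C₂ * ε ^ 2))
    (hDfix : ∀ B : 𝒴, ‖B‖ < ε → Ct (B - hop (Dt B)) = Dt B)
    (hκX : ∀ X, κX (κX X) = X) (hκY : ∀ B, κY (κY B) = B)
    (hhop : ∀ X, hop (κX X) = κY (hop X)) (hCt : ∀ Y : 𝒴, ‖Y‖ < R → Ct (κY Y) = κX (Ct Y))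
    {B₀ : 𝒴} (hB₀ : ‖B₀‖ < ε) (hreal : κY B₀ = B₀) (v : 𝒴) :
    (hop.mkContinuous b hHop ∘L fderiv ℂ Dt B₀) (κY v) = κY ((hop.mkContinuous b hHop ∘L fderiv ℂ Dt B₀) v) := by
  have h := jacobianOp_conj hC hCa hC₂ hb hHop hq hRC hDball hDfix hκX hκY hhop hCt hB₀ v
  rwa [hreal] at h

/-- **`DΦ(κB₀)(κv) = κ(DΦ(B₀)v)`** for the Jacobian operator `DΦ(B) = fderiv ℂ Φ B = 1 − J(B)`
(`B12JacobianTrLog268.fderiv_phi`). [folklore] -/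
theorem fderiv_phi_conj (hC : QuadAnalytic Ct C₂ R) (hCa : AnalyticOnNhd ℂ Ct {Y : 𝒴 | ‖Y‖ < R})
    (hC₂ : 0 ≤ C₂) (hb : 0 ≤ b) (hHop : ∀ X, ‖hop X‖ ≤ b * ‖X‖) (hq : 9 * C₂ * b * ε < 1)
    (hRC : 3 * ε ≤ R) (hDball : ∀ B : 𝒴, ‖B‖ < ε → Dt B ∈ closedBall (0:𝒳) (4 * C₂ * ε ^ 2))
    (hDfix : ∀ B : 𝒴, ‖B‖ < ε → Ct (B - hop (Dt B)) = Dt B)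
    (hκX : ∀ X, κX (κX X) = X) (hκY : ∀ B, κY (κY B) = B)
    (hhop : ∀ X, hop (κX X) = κY (hop X)) (hCt : ∀ Y : 𝒴, ‖Y‖ < R → Ct (κY Y) = κX (Ct Y))
    {B₀ : 𝒴} (hB₀ : ‖B₀‖ < ε) (v : 𝒴) :
    fderiv ℂ (fun B => B - hop (Dt B)) (κY B₀) (κY v) = κY (fderiv ℂ (fun B => B - hop (Dt B)) B₀ v) := by
  have hκB₀ : ‖κY B₀‖ < ε := by rwa [κY.norm_map]
  rw [fderiv_phi hC hCa hC₂ hb hHop hq hRC hDball hDfix hκB₀, fderiv_phi hC hCa hC₂ hb hHop hq hRC hDball hDfix hB₀]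
  simp only [sub_apply, one_apply_eq_self, map_sub,
    jacobianOp_conj hC hCa hC₂ hb hHop hq hRC hDball hDfix hκX hκY hhop hCt hB₀ v]

/-- **At a real point the Jacobian operator `DΦ(B₀)` COMMUTES WITH THE CONJUGATION**: `DΦ(B₀)(κv) = κ(DΦ(B₀)v)`.
[folklore] -/
theorem fderiv_phi_real (hC : QuadAnalytic Ct C₂ R) (hCa : AnalyticOnNhd ℂ Ct {Y : 𝒴 | ‖Y‖ < R})
    (hC₂ : 0 ≤ C₂) (hb : 0 ≤ b) (hHop : ∀ X, ‖hop X‖ ≤ b * ‖X‖) (hq : 9 * C₂ * b * ε < 1)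
    (hRC : 3 * ε ≤ R) (hDball : ∀ B : 𝒴, ‖B‖ < ε → Dt B ∈ closedBall (0:𝒳) (4 * C₂ * ε ^ 2))
    (hDfix : ∀ B : 𝒴, ‖B‖ < ε → Ct (B - hop (Dt B)) = Dt B)
    (hκX : ∀ X, κX (κX X) = X) (hκY : ∀ B, κY (κY B) = B)
    (hhop : ∀ X, hop (κX X) = κY (hop X)) (hCt : ∀ Y : 𝒴, ‖Y‖ < R → Ct (κY Y) = κX (Ct Y))
    {B₀ : 𝒴} (hB₀ : ‖B₀‖ < ε) (hreal : κY B₀ = B₀) (v : 𝒴) :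
    fderiv ℂ (fun B => B - hop (Dt B)) B₀ (κY v) = κY (fderiv ℂ (fun B => B - hop (Dt B)) B₀ v) := by
  have h := fderiv_phi_conj hC hCa hC₂ hb hHop hq hRC hDball hDfix hκX hκY hhop hCt hB₀ v
  rwa [hreal] at h

end equivariance

/-! ## §3  Finite dimension: at a real point `det DΦ(B₀)` and `Tr J(B₀)` are real, `det DΦ(B₀) > 0` on the real ball
(connectedness), and `log det DΦ(B₀)` is real -/
section determinant

variable {𝒳 𝒴 : Type*} [NormedAddCommGroup 𝒳] [NormedSpace ℂ 𝒳] [CompleteSpace 𝒳]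
  [NormedAddCommGroup 𝒴] [NormedSpace ℂ 𝒴] [CompleteSpace 𝒴] [FiniteDimensional ℂ 𝒴]
  {hop : 𝒳 →ₗ[ℂ] 𝒴} {Ct : 𝒴 → 𝒳} {C₂ R b ε : ℝ} {Dt : 𝒴 → 𝒳}
  {κX : 𝒳 ≃ₗᵢ⋆[ℂ] 𝒳} {κY : 𝒴 ≃ₗᵢ⋆[ℂ] 𝒴}

/-- **At a real point the Jacobian determinant is REAL**: `conj (det DΦ(B₀)) = det DΦ(B₀)`. [folklore] -/
theorem conj_det_jacobian (hC : QuadAnalytic Ct C₂ R) (hCa : AnalyticOnNhd ℂ Ct {Y : 𝒴 | ‖Y‖ < R})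
    (hC₂ : 0 ≤ C₂) (hb : 0 ≤ b) (hHop : ∀ X, ‖hop X‖ ≤ b * ‖X‖) (hq : 9 * C₂ * b * ε < 1)
    (hRC : 3 * ε ≤ R) (hDball : ∀ B : 𝒴, ‖B‖ < ε → Dt B ∈ closedBall (0:𝒳) (4 * C₂ * ε ^ 2))
    (hDfix : ∀ B : 𝒴, ‖B‖ < ε → Ct (B - hop (Dt B)) = Dt B)
    (hκX : ∀ X, κX (κX X) = X) (hκY : ∀ B, κY (κY B) = B)
    (hhop : ∀ X, hop (κX X) = κY (hop X)) (hCt : ∀ Y : 𝒴, ‖Y‖ < R → Ct (κY Y) = κX (Ct Y))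
    {B₀ : 𝒴} (hB₀ : ‖B₀‖ < ε) (hreal : κY B₀ = B₀) :
    starRingEnd ℂ (LinearMap.det ((fderiv ℂ (fun B => B - hop (Dt B)) B₀ : 𝒴 →L[ℂ] 𝒴) : 𝒴 →ₗ[ℂ] 𝒴)) =
      LinearMap.det ((fderiv ℂ (fun B => B - hop (Dt B)) B₀ : 𝒴 →L[ℂ] 𝒴) : 𝒴 →ₗ[ℂ] 𝒴) :=
  conj_det_eq κY (map_add κY) (κY.map_smulₛₗ) hκY _ fun v => by
    rw [ContinuousLinearMap.coe_coe]
    exact fderiv_phi_real hC hCa hC₂ hb hHop hq hRC hDball hDfix hκX hκY hhop hCt hB₀ hreal v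

/-- Real Jacobian determinant at a real point, imaginary-part form. [folklore] -/
theorem det_jacobian_im_eq_zero (hC : QuadAnalytic Ct C₂ R) (hCa : AnalyticOnNhd ℂ Ct {Y : 𝒴 | ‖Y‖ < R})
    (hC₂ : 0 ≤ C₂) (hb : 0 ≤ b) (hHop : ∀ X, ‖hop X‖ ≤ b * ‖X‖) (hq : 9 * C₂ * b * ε < 1)
    (hRC : 3 * ε ≤ R) (hDball : ∀ B : 𝒴, ‖B‖ < ε → Dt B ∈ closedBall (0:𝒳) (4 * C₂ * ε ^ 2))
    (hDfix : ∀ B : 𝒴, ‖B‖ < ε → Ct (B - hop (Dt B)) = Dt B)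
    (hκX : ∀ X, κX (κX X) = X) (hκY : ∀ B, κY (κY B) = B)
    (hhop : ∀ X, hop (κX X) = κY (hop X)) (hCt : ∀ Y : 𝒴, ‖Y‖ < R → Ct (κY Y) = κX (Ct Y))
    {B₀ : 𝒴} (hB₀ : ‖B₀‖ < ε) (hreal : κY B₀ = B₀) :
    (LinearMap.det ((fderiv ℂ (fun B => B - hop (Dt B)) B₀ : 𝒴 →L[ℂ] 𝒴) : 𝒴 →ₗ[ℂ] 𝒴)).im = 0 :=
  Complex.conj_eq_iff_im.mp (conj_det_jacobian hC hCa hC₂ hb hHop hq hRC hDball hDfix hκX hκY hhop hCt hB₀ hreal)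

/-- Real Jacobian determinant at a real point, real-part form `det DΦ(B₀) = Re det DΦ(B₀)`. [folklore] -/
theorem det_jacobian_eq_ofReal_re (hC : QuadAnalytic Ct C₂ R) (hCa : AnalyticOnNhd ℂ Ct {Y : 𝒴 | ‖Y‖ < R})
    (hC₂ : 0 ≤ C₂) (hb : 0 ≤ b) (hHop : ∀ X, ‖hop X‖ ≤ b * ‖X‖) (hq : 9 * C₂ * b * ε < 1)
    (hRC : 3 * ε ≤ R) (hDball : ∀ B : 𝒴, ‖B‖ < ε → Dt B ∈ closedBall (0:𝒳) (4 * C₂ * ε ^ 2))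
    (hDfix : ∀ B : 𝒴, ‖B‖ < ε → Ct (B - hop (Dt B)) = Dt B)
    (hκX : ∀ X, κX (κX X) = X) (hκY : ∀ B, κY (κY B) = B)
    (hhop : ∀ X, hop (κX X) = κY (hop X)) (hCt : ∀ Y : 𝒴, ‖Y‖ < R → Ct (κY Y) = κX (Ct Y))
    {B₀ : 𝒴} (hB₀ : ‖B₀‖ < ε) (hreal : κY B₀ = B₀) :
    LinearMap.det ((fderiv ℂ (fun B => B - hop (Dt B)) B₀ : 𝒴 →L[ℂ] 𝒴) : 𝒴 →ₗ[ℂ] 𝒴) =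
      ((LinearMap.det ((fderiv ℂ (fun B => B - hop (Dt B)) B₀ : 𝒴 →L[ℂ] 𝒴) : 𝒴 →ₗ[ℂ] 𝒴)).re : ℂ) :=
  (Complex.conj_eq_iff_re.mp
    (conj_det_jacobian hC hCa hC₂ hb hHop hq hRC hDball hDfix hκX hκY hhop hCt hB₀ hreal)).symm

/-- **At a real point `Tr J(B₀)` is REAL** (`J(B₀) = h∘DD̃(B₀)` commutes with the conjugation). [folklore] -/
theorem conj_trace_jacobianOp (hC : QuadAnalytic Ct C₂ R) (hCa : AnalyticOnNhd ℂ Ct {Y : 𝒴 | ‖Y‖ < R})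
    (hC₂ : 0 ≤ C₂) (hb : 0 ≤ b) (hHop : ∀ X, ‖hop X‖ ≤ b * ‖X‖) (hq : 9 * C₂ * b * ε < 1)
    (hRC : 3 * ε ≤ R) (hDball : ∀ B : 𝒴, ‖B‖ < ε → Dt B ∈ closedBall (0:𝒳) (4 * C₂ * ε ^ 2))
    (hDfix : ∀ B : 𝒴, ‖B‖ < ε → Ct (B - hop (Dt B)) = Dt B)
    (hκX : ∀ X, κX (κX X) = X) (hκY : ∀ B, κY (κY B) = B)
    (hhop : ∀ X, hop (κX X) = κY (hop X)) (hCt : ∀ Y : 𝒴, ‖Y‖ < R → Ct (κY Y) = κX (Ct Y))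
    {B₀ : 𝒴} (hB₀ : ‖B₀‖ < ε) (hreal : κY B₀ = B₀) :
    starRingEnd ℂ (LinearMap.trace ℂ 𝒴 ((hop.mkContinuous b hHop ∘L fderiv ℂ Dt B₀ : 𝒴 →L[ℂ] 𝒴) : 𝒴 →ₗ[ℂ] 𝒴)) =
      LinearMap.trace ℂ 𝒴 ((hop.mkContinuous b hHop ∘L fderiv ℂ Dt B₀ : 𝒴 →L[ℂ] 𝒴) : 𝒴 →ₗ[ℂ] 𝒴) :=
  conj_trace_eq κY (map_add κY) (κY.map_smulₛₗ) hκY _ fun v => by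
    rw [ContinuousLinearMap.coe_coe]
    exact jacobianOp_real hC hCa hC₂ hb hHop hq hRC hDball hDfix hκX hκY hhop hCt hB₀ hreal v

/-- **POSITIVITY OF THE JACOBIAN ON THE REAL BALL: `det DΦ(B₀) > 0`** for `κB₀ = B₀`, `‖B₀‖ < ε` (`9C₂bε ≤ 1/2`).
The argument: on the real ball `{κB = B} ∩ {‖B‖ < ε}` — convex, hence connected (§1) — the function
`B ↦ det DΦ(B)` is real-valued (above), continuous (`B12JacobianTrLog268.analyticOnNhd_det_jacobian`), never zero
(`det_jacobian_ne_zero`) and equal to `1` at `B = 0` (`det_jacobian_zero`); by the intermediate value theorem it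
cannot take a non-positive value.  Hence the substitution `B′ = B − hD̃(B)` in the real integral (2.10) has Jacobian
`|det DΦ| = det DΦ = exp Tr log DΦ`, the form used in (2.12). [folklore] -/
theorem det_jacobian_pos (hC : QuadAnalytic Ct C₂ R) (hCa : AnalyticOnNhd ℂ Ct {Y : 𝒴 | ‖Y‖ < R})
    (hC₂ : 0 ≤ C₂) (hb : 0 ≤ b) (hHop : ∀ X, ‖hop X‖ ≤ b * ‖X‖) (hq2 : 9 * C₂ * b * ε ≤ 1 / 2)
    (hRC : 3 * ε ≤ R) (hDball : ∀ B : 𝒴, ‖B‖ < ε → Dt B ∈ closedBall (0:𝒳) (4 * C₂ * ε ^ 2))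
    (hDfix : ∀ B : 𝒴, ‖B‖ < ε → Ct (B - hop (Dt B)) = Dt B)
    (hκX : ∀ X, κX (κX X) = X) (hκY : ∀ B, κY (κY B) = B)
    (hhop : ∀ X, hop (κX X) = κY (hop X)) (hCt : ∀ Y : 𝒴, ‖Y‖ < R → Ct (κY Y) = κX (Ct Y))
    {B₀ : 𝒴} (hB₀ : ‖B₀‖ < ε) (hreal : κY B₀ = B₀) :
    0 < (LinearMap.det ((fderiv ℂ (fun B => B - hop (Dt B)) B₀ : 𝒴 →L[ℂ] 𝒴) : 𝒴 →ₗ[ℂ] 𝒴)).re := by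
  have hq : 9 * C₂ * b * ε < 1 := lt_one_of_le_half hq2
  have hε : 0 < ε := lt_of_le_of_lt (norm_nonneg _) hB₀
  set S : Set 𝒴 := {B : 𝒴 | κY B = B} ∩ ball (0:𝒴) ε with hS_def
  set f : 𝒴 → ℝ := fun B =>
    (LinearMap.det ((fderiv ℂ (fun B => B - hop (Dt B)) B : 𝒴 →L[ℂ] 𝒴) : 𝒴 →ₗ[ℂ] 𝒴)).re with hf_def
  have hSconn : IsPreconnected S := isPreconnected_fixed_inter_ball κY ε
  have hcont : ContinuousOn f S :=
    (Complex.continuous_re.comp_continuousOn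
      (analyticOnNhd_det_jacobian hC hCa hC₂ hb hHop hq2 hRC hDball hDfix).continuousOn).mono inter_subset_right
  have h0S : (0:𝒴) ∈ S := ⟨by simp, by simpa using hε⟩
  have hB₀S : B₀ ∈ S := ⟨hreal, mem_ball_zero_iff.mpr hB₀⟩
  have hf0 : f 0 = 1 := by
    simp only [hf_def]
    rw [det_jacobian_zero hC hCa hC₂ hb hHop hq hRC hDball hDfix hε, Complex.one_re]
  show 0 < f B₀
  by_contra hneg
  rw [not_lt] at hneg
  have hIcc : (0:ℝ) ∈ Icc (f B₀) (f 0) := ⟨hneg, by rw [hf0]; exact zero_le_one⟩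
  obtain ⟨B₁, hB₁S, hfB₁⟩ := hSconn.intermediate_value hB₀S h0S hcont hIcc
  have hB₁ : ‖B₁‖ < ε := mem_ball_zero_iff.mp hB₁S.2
  have hre : (LinearMap.det ((fderiv ℂ (fun B => B - hop (Dt B)) B₁ : 𝒴 →L[ℂ] 𝒴) : 𝒴 →ₗ[ℂ] 𝒴)).re = 0 := by
    simpa [hf_def] using hfB₁
  have hzero : LinearMap.det ((fderiv ℂ (fun B => B - hop (Dt B)) B₁ : 𝒴 →L[ℂ] 𝒴) : 𝒴 →ₗ[ℂ] 𝒴) = 0 := by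
    rw [det_jacobian_eq_ofReal_re hC hCa hC₂ hb hHop hq hRC hDball hDfix hκX hκY hhop hCt hB₁ hB₁S.1, hre,
      Complex.ofReal_zero]
  exact det_jacobian_ne_zero hC hCa hC₂ hb hHop hq2 hRC hDball hDfix hB₁ hzero

/-- **`det DΦ(B₀)` is a POSITIVE REAL number at a real point**: `det DΦ(B₀) = r` with `0 < r`. [folklore] -/
theorem det_jacobian_eq_ofReal_pos (hC : QuadAnalytic Ct C₂ R) (hCa : AnalyticOnNhd ℂ Ct {Y : 𝒴 | ‖Y‖ < R})
    (hC₂ : 0 ≤ C₂) (hb : 0 ≤ b) (hHop : ∀ X, ‖hop X‖ ≤ b * ‖X‖) (hq2 : 9 * C₂ * b * ε ≤ 1 / 2)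
    (hRC : 3 * ε ≤ R) (hDball : ∀ B : 𝒴, ‖B‖ < ε → Dt B ∈ closedBall (0:𝒳) (4 * C₂ * ε ^ 2))
    (hDfix : ∀ B : 𝒴, ‖B‖ < ε → Ct (B - hop (Dt B)) = Dt B)
    (hκX : ∀ X, κX (κX X) = X) (hκY : ∀ B, κY (κY B) = B)
    (hhop : ∀ X, hop (κX X) = κY (hop X)) (hCt : ∀ Y : 𝒴, ‖Y‖ < R → Ct (κY Y) = κX (Ct Y))
    {B₀ : 𝒴} (hB₀ : ‖B₀‖ < ε) (hreal : κY B₀ = B₀) :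
    ∃ r : ℝ, 0 < r ∧
      LinearMap.det ((fderiv ℂ (fun B => B - hop (Dt B)) B₀ : 𝒴 →L[ℂ] 𝒴) : 𝒴 →ₗ[ℂ] 𝒴) = (r : ℂ) :=
  ⟨_, det_jacobian_pos hC hCa hC₂ hb hHop hq2 hRC hDball hDfix hκX hκY hhop hCt hB₀ hreal,
    det_jacobian_eq_ofReal_re hC hCa hC₂ hb hHop (lt_one_of_le_half hq2) hRC hDball hDfix hκX hκY hhop hCt hB₀
      hreal⟩

/-- **`log det DΦ(B₀)` IS REAL at a real point**: the principal-branch complex logarithm of the Jacobian determinant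
is the real logarithm of the positive number `det DΦ(B₀)`. [folklore] -/
theorem log_det_jacobian_eq_ofReal (hC : QuadAnalytic Ct C₂ R) (hCa : AnalyticOnNhd ℂ Ct {Y : 𝒴 | ‖Y‖ < R})
    (hC₂ : 0 ≤ C₂) (hb : 0 ≤ b) (hHop : ∀ X, ‖hop X‖ ≤ b * ‖X‖) (hq2 : 9 * C₂ * b * ε ≤ 1 / 2)
    (hRC : 3 * ε ≤ R) (hDball : ∀ B : 𝒴, ‖B‖ < ε → Dt B ∈ closedBall (0:𝒳) (4 * C₂ * ε ^ 2))
    (hDfix : ∀ B : 𝒴, ‖B‖ < ε → Ct (B - hop (Dt B)) = Dt B)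
    (hκX : ∀ X, κX (κX X) = X) (hκY : ∀ B, κY (κY B) = B)
    (hhop : ∀ X, hop (κX X) = κY (hop X)) (hCt : ∀ Y : 𝒴, ‖Y‖ < R → Ct (κY Y) = κX (Ct Y))
    {B₀ : 𝒴} (hB₀ : ‖B₀‖ < ε) (hreal : κY B₀ = B₀) :
    Complex.log (LinearMap.det ((fderiv ℂ (fun B => B - hop (Dt B)) B₀ : 𝒴 →L[ℂ] 𝒴) : 𝒴 →ₗ[ℂ] 𝒴)) =
      ((Real.log (LinearMap.det
        ((fderiv ℂ (fun B => B - hop (Dt B)) B₀ : 𝒴 →L[ℂ] 𝒴) : 𝒴 →ₗ[ℂ] 𝒴)).re : ℝ) : ℂ) := by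
  have hpos := det_jacobian_pos hC hCa hC₂ hb hHop hq2 hRC hDball hDfix hκX hκY hhop hCt hB₀ hreal
  have hre := det_jacobian_eq_ofReal_re hC hCa hC₂ hb hHop (lt_one_of_le_half hq2) hRC hDball hDfix hκX hκY hhop
    hCt hB₀ hreal
  conv_lhs => rw [hre]
  rw [Complex.ofReal_log hpos.le]

/-- `Im log det DΦ(B₀) = 0` at a real point. [folklore] -/
theorem log_det_jacobian_im_eq_zero (hC : QuadAnalytic Ct C₂ R) (hCa : AnalyticOnNhd ℂ Ct {Y : 𝒴 | ‖Y‖ < R})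
    (hC₂ : 0 ≤ C₂) (hb : 0 ≤ b) (hHop : ∀ X, ‖hop X‖ ≤ b * ‖X‖) (hq2 : 9 * C₂ * b * ε ≤ 1 / 2)
    (hRC : 3 * ε ≤ R) (hDball : ∀ B : 𝒴, ‖B‖ < ε → Dt B ∈ closedBall (0:𝒳) (4 * C₂ * ε ^ 2))
    (hDfix : ∀ B : 𝒴, ‖B‖ < ε → Ct (B - hop (Dt B)) = Dt B)
    (hκX : ∀ X, κX (κX X) = X) (hκY : ∀ B, κY (κY B) = B)
    (hhop : ∀ X, hop (κX X) = κY (hop X)) (hCt : ∀ Y : 𝒴, ‖Y‖ < R → Ct (κY Y) = κX (Ct Y))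
    {B₀ : 𝒴} (hB₀ : ‖B₀‖ < ε) (hreal : κY B₀ = B₀) :
    (Complex.log (LinearMap.det ((fderiv ℂ (fun B => B - hop (Dt B)) B₀ : 𝒴 →L[ℂ] 𝒴) : 𝒴 →ₗ[ℂ] 𝒴))).im = 0 := by
  rw [log_det_jacobian_eq_ofReal hC hCa hC₂ hb hHop hq2 hRC hDball hDfix hκX hκY hhop hCt hB₀ hreal,
    Complex.ofReal_im]

end determinant

/-! ## §4  Transcription: the real structure of the linearizing change of variables of B12 p. 267 -/
section transcription

variable {𝒳 𝒴 : Type*} [NormedAddCommGroup 𝒳] [NormedSpace ℂ 𝒳] [CompleteSpace 𝒳]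
  [NormedAddCommGroup 𝒴] [NormedSpace ℂ 𝒴] [CompleteSpace 𝒴]

/-- **B12 p. 267 «an analytic, 𝐠-valued function D̃(B′)» — the REAL STRUCTURE of the change of variables
`B′ = B − hD̃(B)`, BANACH PART (any complex Banach spaces with conjugations).**  For the solution `D̃` of
`C̃(B − hD̃(B)) = D̃(B)` on `‖B‖ < ε` of `B12Lineariz267.p267_linearizing_change_of_variables` (any `D̃` with values
in the ball `4C₂ε²` solving the equation), under the hypotheses of `B12LinearizAnalytic267.p267_analytic_function_of_B`,
and for conjugations `κ_𝒳`, `κ_𝒴` under which `h` and `C̃` are equivariant («transforms 𝐠-valued functions … into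
such functions»): (i) `D̃(κB) = κD̃(B)` and `Φ(κB) = κΦ(B)` on the ball — in particular `D̃` and `Φ` map real
(`κB = B`, «𝐠-valued») fields to real fields; (ii) at every real point `B₀` of the ball the derivative `DD̃(B₀)`,
the operator `J(B₀) = h∘DD̃(B₀)` of (2.12) and the Jacobian operator `DΦ(B₀)` commute with the conjugations.
Everything about `D̃`, `C̃`, `h`, `κ` is a HYPOTHESIS; nothing printed is asserted. [cite: Balaban1987RG1, p.267] -/
theorem p267_real_structure {hop : 𝒳 →ₗ[ℂ] 𝒴} {Ct : 𝒴 → 𝒳} {C₂ R b ε : ℝ} {Dt : 𝒴 → 𝒳}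
    {κX : 𝒳 ≃ₗᵢ⋆[ℂ] 𝒳} {κY : 𝒴 ≃ₗᵢ⋆[ℂ] 𝒴}
    (hC : QuadAnalytic Ct C₂ R) (hCa : AnalyticOnNhd ℂ Ct {Y : 𝒴 | ‖Y‖ < R})
    (hC₂ : 0 ≤ C₂) (hb : 0 ≤ b) (hHop : ∀ X, ‖hop X‖ ≤ b * ‖X‖) (hq : 9 * C₂ * b * ε < 1)
    (hRC : 3 * ε ≤ R) (hDball : ∀ B : 𝒴, ‖B‖ < ε → Dt B ∈ closedBall (0:𝒳) (4 * C₂ * ε ^ 2))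
    (hDfix : ∀ B : 𝒴, ‖B‖ < ε → Ct (B - hop (Dt B)) = Dt B)
    (hκX : ∀ X, κX (κX X) = X) (hκY : ∀ B, κY (κY B) = B)
    (hhop : ∀ X, hop (κX X) = κY (hop X)) (hCt : ∀ Y : 𝒴, ‖Y‖ < R → Ct (κY Y) = κX (Ct Y)) :
    (∀ B : 𝒴, ‖B‖ < ε → Dt (κY B) = κX (Dt B) ∧ κY B - hop (Dt (κY B)) = κY (B - hop (Dt B))) ∧
    (∀ B : 𝒴, ‖B‖ < ε → κY B = B → κX (Dt B) = Dt B ∧ κY (B - hop (Dt B)) = B - hop (Dt B)) ∧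
    (∀ B₀ : 𝒴, ‖B₀‖ < ε → κY B₀ = B₀ → ∀ v : 𝒴,
      fderiv ℂ Dt B₀ (κY v) = κX (fderiv ℂ Dt B₀ v) ∧
      (hop.mkContinuous b hHop ∘L fderiv ℂ Dt B₀) (κY v) = κY ((hop.mkContinuous b hHop ∘L fderiv ℂ Dt B₀) v) ∧
      fderiv ℂ (fun B => B - hop (Dt B)) B₀ (κY v) = κY (fderiv ℂ (fun B => B - hop (Dt B)) B₀ v)) :=
  ⟨fun _ hB => ⟨Dt_conj hC hC₂ hb hHop hq hRC hDball hDfix hκX hκY hhop hCt hB,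
      phi_conj hC hC₂ hb hHop hq hRC hDball hDfix hκX hκY hhop hCt hB⟩,
    fun _ hB hreal => ⟨Dt_real hC hC₂ hb hHop hq hRC hDball hDfix hκX hκY hhop hCt hB hreal,
      phi_real hC hC₂ hb hHop hq hRC hDball hDfix hκX hκY hhop hCt hB hreal⟩,
    fun _ hB₀ hreal v => ⟨fderiv_Dt_real hC hCa hC₂ hb hHop hq hRC hDball hDfix hκX hκY hhop hCt hB₀ hreal v,
      jacobianOp_real hC hCa hC₂ hb hHop hq hRC hDball hDfix hκX hκY hhop hCt hB₀ hreal v,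
      fderiv_phi_real hC hCa hC₂ hb hHop hq hRC hDball hDfix hκX hκY hhop hCt hB₀ hreal v⟩⟩

/-- **B12 p. 267 ∕ (2.12) p. 268 — the REAL STRUCTURE of the change of variables, FINITE-DIMENSIONAL PART** (`𝒴`
finite-dimensional, as for the lattice `𝐠`-valued functions of [B12]; `9C₂bε ≤ 1/2`).  At every real point `B₀`
of the ball: (i) the Jacobian determinant `det DΦ(B₀)` is REAL and (ii) POSITIVE — `det DΦ(B₀) = r > 0` — so that
the Jacobian of the substitution `B′ = B − hD̃(B)` in the real integral (2.10) is `|det DΦ| = det DΦ = exp Tr log DΦ`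
(`B12JacobianTrLog268.cexp_trace_logJacobian_eq_det_fderiv_phi`), the form of the term «Tr log(I − h((δ/δB)D̃)(g_kCB))»
of (2.12); (iii) `log det DΦ(B₀)` is the real number `Real.log det DΦ(B₀)`; (iv) `Tr J(B₀)` is real.  Everything
about `D̃`, `C̃`, `h`, `κ` is a HYPOTHESIS; nothing printed is asserted. [cite: Balaban1987RG1, pp.267-268] -/
theorem p267_real_jacobian_findim [FiniteDimensional ℂ 𝒴] {hop : 𝒳 →ₗ[ℂ] 𝒴} {Ct : 𝒴 → 𝒳} {C₂ R b ε : ℝ}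
    {Dt : 𝒴 → 𝒳} {κX : 𝒳 ≃ₗᵢ⋆[ℂ] 𝒳} {κY : 𝒴 ≃ₗᵢ⋆[ℂ] 𝒴}
    (hC : QuadAnalytic Ct C₂ R) (hCa : AnalyticOnNhd ℂ Ct {Y : 𝒴 | ‖Y‖ < R})
    (hC₂ : 0 ≤ C₂) (hb : 0 ≤ b) (hHop : ∀ X, ‖hop X‖ ≤ b * ‖X‖) (hq2 : 9 * C₂ * b * ε ≤ 1 / 2)
    (hRC : 3 * ε ≤ R) (hDball : ∀ B : 𝒴, ‖B‖ < ε → Dt B ∈ closedBall (0:𝒳) (4 * C₂ * ε ^ 2))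
    (hDfix : ∀ B : 𝒴, ‖B‖ < ε → Ct (B - hop (Dt B)) = Dt B)
    (hκX : ∀ X, κX (κX X) = X) (hκY : ∀ B, κY (κY B) = B)
    (hhop : ∀ X, hop (κX X) = κY (hop X)) (hCt : ∀ Y : 𝒴, ‖Y‖ < R → Ct (κY Y) = κX (Ct Y))
    {B₀ : 𝒴} (hB₀ : ‖B₀‖ < ε) (hreal : κY B₀ = B₀) :
    starRingEnd ℂ (LinearMap.det ((fderiv ℂ (fun B => B - hop (Dt B)) B₀ : 𝒴 →L[ℂ] 𝒴) : 𝒴 →ₗ[ℂ] 𝒴)) =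
        LinearMap.det ((fderiv ℂ (fun B => B - hop (Dt B)) B₀ : 𝒴 →L[ℂ] 𝒴) : 𝒴 →ₗ[ℂ] 𝒴) ∧
    (∃ r : ℝ, 0 < r ∧
      LinearMap.det ((fderiv ℂ (fun B => B - hop (Dt B)) B₀ : 𝒴 →L[ℂ] 𝒴) : 𝒴 →ₗ[ℂ] 𝒴) = (r : ℂ)) ∧
    Complex.log (LinearMap.det ((fderiv ℂ (fun B => B - hop (Dt B)) B₀ : 𝒴 →L[ℂ] 𝒴) : 𝒴 →ₗ[ℂ] 𝒴)) =
      ((Real.log (LinearMap.det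
        ((fderiv ℂ (fun B => B - hop (Dt B)) B₀ : 𝒴 →L[ℂ] 𝒴) : 𝒴 →ₗ[ℂ] 𝒴)).re : ℝ) : ℂ) ∧
    starRingEnd ℂ (LinearMap.trace ℂ 𝒴 ((hop.mkContinuous b hHop ∘L fderiv ℂ Dt B₀ : 𝒴 →L[ℂ] 𝒴) : 𝒴 →ₗ[ℂ] 𝒴)) =
      LinearMap.trace ℂ 𝒴 ((hop.mkContinuous b hHop ∘L fderiv ℂ Dt B₀ : 𝒴 →L[ℂ] 𝒴) : 𝒴 →ₗ[ℂ] 𝒴) :=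
  ⟨conj_det_jacobian hC hCa hC₂ hb hHop (lt_one_of_le_half hq2) hRC hDball hDfix hκX hκY hhop hCt hB₀ hreal,
    det_jacobian_eq_ofReal_pos hC hCa hC₂ hb hHop hq2 hRC hDball hDfix hκX hκY hhop hCt hB₀ hreal,
    log_det_jacobian_eq_ofReal hC hCa hC₂ hb hHop hq2 hRC hDball hDfix hκX hκY hhop hCt hB₀ hreal,
    conj_trace_jacobianOp hC hCa hC₂ hb hHop (lt_one_of_le_half hq2) hRC hDball hDfix hκX hκY hhop hCt hB₀ hreal⟩

/-- Non-vacuity of the hypothesis set: the degenerate model `𝒳 = 𝒴 = ℂ`, `κ_𝒳 = κ_𝒴 =` complex conjugation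
(`starₗᵢ ℂ`), `h = id`, `C̃ = 0`, `D̃ = 0`, `C₂ = 0`, `R = 3`, `b = 1`, `ε = 1` satisfies every hypothesis of
`p267_real_structure` ∕ `p267_real_jacobian_findim`, and `B₀ = 1/2` is a real point of the ball. -/
example : ∃ (hop : ℂ →ₗ[ℂ] ℂ) (Ct : ℂ → ℂ) (C₂ R b ε : ℝ) (Dt : ℂ → ℂ) (κX κY : ℂ ≃ₗᵢ⋆[ℂ] ℂ) (B₀ : ℂ),
    QuadAnalytic Ct C₂ R ∧ AnalyticOnNhd ℂ Ct {Y : ℂ | ‖Y‖ < R} ∧ 0 ≤ C₂ ∧ 0 ≤ b ∧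
    (∀ X, ‖hop X‖ ≤ b * ‖X‖) ∧ 9 * C₂ * b * ε ≤ 1 / 2 ∧ 3 * ε ≤ R ∧
    (∀ B : ℂ, ‖B‖ < ε → Dt B ∈ closedBall (0:ℂ) (4 * C₂ * ε ^ 2)) ∧
    (∀ B : ℂ, ‖B‖ < ε → Ct (B - hop (Dt B)) = Dt B) ∧
    (∀ X, κX (κX X) = X) ∧ (∀ B, κY (κY B) = B) ∧ (∀ X, hop (κX X) = κY (hop X)) ∧
    (∀ Y : ℂ, ‖Y‖ < R → Ct (κY Y) = κX (Ct Y)) ∧ ‖B₀‖ < ε ∧ κY B₀ = B₀ := by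
  refine ⟨LinearMap.id, fun _ => 0, 0, 3, 1, 1, fun _ => 0, starₗᵢ ℂ, starₗᵢ ℂ, (1/2 : ℝ),
    ⟨fun Y _ => by simp, fun P Q => ?_⟩, fun Y _ => analyticAt_const, le_rfl, zero_le_one, fun X => by simp,
    by norm_num, by norm_num, fun B _ => by simp, fun B _ => rfl, fun X => by simp, fun B => by simp,
    fun X => by simp, fun Y _ => by simp, ?_, ?_⟩
  · exact differentiableOn_const 0
  · rw [Complex.norm_real]; norm_num
  · rw [starₗᵢ_apply]
    exact Complex.conj_ofReal _

end transcription

end Literature.MathematicalPhysics.QuantumFieldTheory.Balaban1983to89.B12JacobianReal267
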